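import Summits.CriticalPhenomena.PercolationContinuityZ3.Theorems.Transplant.SqShadowFact2Reduction
import Summits.CriticalPhenomena.PercolationContinuityZ3.Theorems.Transplant.HexShadowRoutePrep
import HarnessLib

/-!
# SQUARE SHADOWS — port of «HexShadowRoutePrep» to the square-shadow interface: first/last visits of `γ_min` to a cleared set of columns and the `src'`-side path `σ` from the (P2)-witness

builds on p205010 (kernel theorem, internal audit signed; external expert review pending) — NOT used in this file.  Lane `prim-bschramm`, seat `prim-bschramm-p2` (gen 42; class C1b;
memo §148); helper file (`--supports stmt-CriticalPhenomena-4575 --as helper`).  Statements and proofs from the hexagonal twin with `Ψ : SqShadow G` for `Φ : HexShadow G`, sup-norm squares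
`sqBall` for lattice hexagons, and the square clipped blocks `sqBlk z t s = sqBall z 3 ∩ {w₀ ≤ z₀ + t} ∩ {w₁ ≤ z₁ + s}` (clipping at the common right side of `B_{3n}`, `B'_n` and at
the top of the window) for the hexagonal ones.
[cite: DuminilCopinSidoraviciusTassion2016, §2.3 (proof of Fact 2, pp. 6–7)] [cite: NewmanTassionWu2017, §3.2]
-/

noncomputable section

namespace Summit.CriticalPhenomena.PercolationContinuityZ3.Theorems.Transplant

open MeasureTheory Literature.Probability.Percolation Literature.Probability.LatticeModels SimpleGraph Filter
open scoped Classical Topology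

namespace SqShadow

variable {V : Type} {G : SimpleGraph V} (Ψ : SqShadow G) [Countable V]

/-- **First and last visits of `γ_min` to a cleared set of columns.**  If `γ = γ_min(ω)` (on `A`) starts and ends off `D̄` and has two distinct vertices over
`D`, then `γ = p₀ ++ E₁ :: (mid ++ E₂ :: s₀)` with `p₀ ≠ []`, `s₀ ≠ []`, both off `D̄`, and `E₁`, `E₂` over `D`.
[cite: DuminilCopinSidoraviciusTassion2016, §2.3 (proof of Fact 2: "u' and v' … the first and last vertices of γ_min which are in B̄_R(z)")] -/
theorem γmin_split_at (Γ : GlueData) {ω : BondConfig V} (hA : ω ∈ Ψ.evA Γ) (D : Set (Site 2))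
    (hhead : ∀ h : Ψ.γmin Γ ω ≠ [], Ψ.sh ((Ψ.γmin Γ ω).head h) ∉ D) (hlast : ∀ h : Ψ.γmin Γ ω ≠ [], Ψ.sh ((Ψ.γmin Γ ω).getLast h) ∉ D)
    (htwo : ∃ a ∈ Ψ.γmin Γ ω, ∃ b ∈ Ψ.γmin Γ ω, a ≠ b ∧ Ψ.sh a ∈ D ∧ Ψ.sh b ∈ D) :
    ∃ (p₀ : List V) (E₁ : V) (mid : List V) (E₂ : V) (s₀ : List V),
      Ψ.γmin Γ ω = p₀ ++ E₁ :: (mid ++ E₂ :: s₀) ∧ p₀ ≠ [] ∧ s₀ ≠ [] ∧ (∀ x ∈ p₀, Ψ.sh x ∉ D) ∧ (∀ x ∈ s₀, Ψ.sh x ∉ D) ∧ Ψ.sh E₁ ∈ D ∧ Ψ.sh E₂ ∈ D := by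
  obtain ⟨hγO, -⟩ := Ψ.γmin_spec Γ hA
  set γ := Ψ.γmin Γ ω with hγdef
  obtain ⟨a, haγ, b, hbγ, hab, haD, hbD⟩ := htwo
  -- first visit
  obtain ⟨p₀, E₁, rest₁, hγ1, hE₁D, hp₀D⟩ := exists_first_split (p := fun x => Ψ.sh x ∈ D) γ ⟨a, haγ, haD⟩
  have hp₀ : p₀ ≠ [] := by
    rintro rfl
    have h := hhead hγO.ne_nil
    simp only [hγ1, List.nil_append, List.head_cons] at h
    exact h hE₁D
  -- a second visit after `E₁`
  have hmeet : ∃ x ∈ rest₁, Ψ.sh x ∈ D := by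
    have key : ∀ {c : V}, c ∈ γ → Ψ.sh c ∈ D → c ≠ E₁ → c ∈ rest₁ := by
      intro c hc hcD hne
      rw [hγ1] at hc
      rcases List.mem_append.1 hc with h | h
      · exact absurd hcD (hp₀D c h)
      · rcases List.mem_cons.1 h with h | h
        · exact absurd h hne
        · exact h
    by_cases haE : a = E₁
    · exact ⟨b, key hbγ hbD (fun h => hab (haE.trans h.symm)), hbD⟩
    · exact ⟨a, key haγ haD haE, haD⟩
  -- last visit
  obtain ⟨mid, E₂, s₀, hrest, hE₂D, hs₀D⟩ := exists_last_split (p := fun x => Ψ.sh x ∈ D) rest₁ hmeet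
  have hs₀ : s₀ ≠ [] := by
    rintro rfl
    have h := hlast hγO.ne_nil
    have : γ.getLast hγO.ne_nil = E₂ := by
      simp only [hγ1, hrest]
      rw [List.getLast_append_of_ne_nil _ (List.cons_ne_nil _ _), List.getLast_cons (by simp), List.getLast_append_of_ne_nil _ (List.cons_ne_nil _ _)]
      simp
    rw [this] at h
    exact h hE₂D
  exact ⟨p₀, E₁, mid, E₂, s₀, by rw [hγ1, hrest], hp₀, hs₀, hp₀D, hs₀D, hE₁D, hE₂D⟩

/-- **The `src'`-side path `σ` from the (P2)-witness.**  For `z ∈ U(ω)` and a set of columns `D ⊇ sqBall z 1`: an `ω`-open chain `σ` (vertex list, consecutive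
vertices joined by open edges) with `σ.head = w` over `D`, all vertices over `small` and off the columns of `γ_min(ω)`, `σ.tail` off `D̄`, and last vertex over
`src'` — the fields `hσ*` of `SqShadow.Surgery` up to the identification `w = Br.getLast`. [cite: DuminilCopinSidoraviciusTassion2016, §2.3 (Definition of U(ω), (P2); proof of Fact 2, the path π)] -/
theorem exists_sigma_of_mem_U (Γ : GlueData) {ω : BondConfig V} {z : Site 2} (hz : z ∈ Ψ.U Γ ω) {D : Set (Site 2)} (hD : sqBall z 1 ⊆ D) :
    ∃ (w : V) (σ : List V), σ.head? = some w ∧ Ψ.sh w ∈ D ∧ σ.IsChain (fun a b => s(a, b) ∈ ω ∧ a ≠ b) ∧ (∀ x ∈ σ, Ψ.sh x ∈ Ψ.small Γ) ∧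
      (∀ x ∈ σ, Ψ.sh x ∉ Ψ.γcols Γ ω) ∧ (∀ x ∈ σ.tail, Ψ.sh x ∉ D) ∧ ∀ h : σ ≠ [], σ.getLast h ∈ Ψ.lift (Ψ.src' Γ) := by
  obtain ⟨-, -, x₀, hx₀, s', hs', hπ⟩ := hz
  obtain ⟨π, hπO⟩ := exists_openSAP_of_openConnIn hπ
  have hx₀π : π.head hπO.ne_nil = x₀ := hπO.head_mem hπO.ne_nil
  have hx₀D : Ψ.sh x₀ ∈ D := hD hx₀
  -- the last vertex of `π` over `D`
  obtain ⟨l₁, w, σt, hsplit, hwD, hσt⟩ := exists_last_split (p := fun x => Ψ.sh x ∈ D) π ⟨x₀, by rw [← hx₀π]; exact List.head_mem _, hx₀D⟩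
  refine ⟨w, w :: σt, rfl, hwD, ?_, ?_, ?_, ?_, ?_⟩
  · have := hπO.chain
    rw [hsplit] at this
    exact (List.isChain_append.1 this).2.1
  · intro x hx
    exact (hπO.subset x (by rw [hsplit]; exact List.mem_append_right _ hx)).1
  · intro x hx
    exact (hπO.subset x (by rw [hsplit]; exact List.mem_append_right _ hx)).2
  · intro x hx
    exact hσt x hx
  · intro h
    have h1 : (w :: σt).getLast h = π.getLast hπO.ne_nil := by
      simp only [hsplit]
      rw [List.getLast_append_of_ne_nil _ (List.cons_ne_nil _ _)]
    rw [h1]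
    have := hπO.last_mem hπO.ne_nil
    rw [Set.mem_singleton_iff] at this
    rw [this]; exact hs'

end SqShadow

end Summit.CriticalPhenomena.PercolationContinuityZ3.Theorems.Transplant

end
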